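import Mathlib
import Summits.Ventures.PercRepro2.TypedPendantPair
import Summits.Ventures.PercRepro2.TypedPendantPairNonneg
import Summits.Ventures.PercRepro2.TypedUntouched
import Summits.Ventures.PercRepro2.TypedContract
import Summits.Ventures.PercRepro2.TypedResidualBase
import Summits.Ventures.PercRepro2.TypedSupportRestrict

/-!
# The pendant `o·b` pair at a class-`2` edge: `N₂ = N₁ + N₃`, and row 2′TRI reduces to the
contracted instance (blind cell PercRepro2, mine-2 g53, 2026-08-29; `conjectures/MINE-2.md` M2-110)

At a leaf `w` carrying both marks `o = b = w` (`TypedPendantPair.lean`) the class-`1` rule reads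
`N₁ = N_{g := 3}(KP)` with the same-slot part `KP ≥ 0`.  At class `2` the peel puts the kill in ONE
copy: the three placements contribute `KP + KQ` (first copy killed), `KP` (second) and `KR`
(third), i.e. the reduced kernel is `KB + KP` (`KB_eq_KP_add`, `KB_killOB`).  Hence
**`typedCount_pendant_pair_two`**: `N₂ = N₃ + N₁` — the class-`2` count is the count with the pair
CONTRACTED onto its neighbour (`g` of type `3`) plus the class-`1` count; with `N₀ = 0`
(**`typedCount_pendant_pair_zero`**: the pair isolated in every copy kills every term) and
`N₁ ≥ 0` this gives (T23) at the pair edge (**`t23_pendant_pair`**: `N₃ ≤ N₂`) and the REDUCTION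
**`typedCount_nonneg_of_pendant_pair_two`**: row 2′TRI on the contracted instance gives it at the
class-`2` pair.  So the pendant pair is a reducible configuration of row 2′TRI at BOTH classes —
discharged at class `1`, reduced one instance down at class `2` — with the Bernstein bases
`(N₀, N₁, N₂, N₃) = (0, N₁, N₁ + N₃, N₃)`: the identity `N₂ = N₁ + N₃` of the series-`2` and
`(1,1)` pendant roots (M2-108) holds at every pendant pair.  The census form
(**`typedCount_pendant_o_b_two`**: `o` a leaf at `b` by an edge of class `≥ 1`, `b` carrying one
further edge `gp` of class `2`) follows by the reduction chain of `TypedPendantPairNonneg.lean`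
(night-3's leaf rule for `o`, the contraction of the pinned-open `o–b` edge, the pinned loop, the
restriction to the support) applied to each of the three counts, and gives the reduction
**`typedCount_nonneg_of_pendant_o_b_two`**.  Own work; standard axioms.
-/

namespace Summit.Ventures.PercRepro2

namespace CovForm

namespace TypedRed

open OneTyped

section PairTwo

open Classical

variable {V : Type*} {E : Type*} [Fintype E] [DecidableEq E] {R : Type*} [Field R]
variable (ends : E → Sym2 V) (a₁ a₂ a₃ w : V)

/-- **The class-`2` peel at a pendant pair**: the typed count of `K₃` with the pair edge `g` of
class `2` is the typed count, with `g` pinned open, of `KB + KP`. -/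
theorem typedCount_pendant_pair_two_pinned {g : E} {v : V} (hg : ends g = s(w, v))
    (hleaf : ∀ e, w ∈ ends e → e = g) (hwv : w ≠ v) (hw1 : w ≠ a₁) (hw2 : w ≠ a₂)
    (hw3 : w ≠ a₃) (F : Finset E) (hgF : g ∈ F) (z : Config E) (τ : E → ℕ) (hτ : τ g = 2) :
    typedCount F z τ (K3 ends w a₁ a₂ a₃ w : Config E → Config E → Config E → R) =
      typedCount (F.erase g) (Function.update z g true) τ (K3 ends w a₁ a₂ a₃ w) +
      typedCount (F.erase g) (Function.update z g true) τ
        (fun x y w' => ((KP (st ends w a₁ a₂ a₃ w x) (st ends w a₁ a₂ a₃ w y)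
          (st ends w a₁ a₂ a₃ w w') : ℤ) : R)) := by
  have h1 : typedCount F z τ (K3 ends w a₁ a₂ a₃ w : Config E → Config E → Config E → R) =
      typedCount F z τ (fun x y w' => ((KB (st ends w a₁ a₂ a₃ w x) (st ends w a₁ a₂ a₃ w y)
        (st ends w a₁ a₂ a₃ w w') : ℤ) : R)) :=
    typedCount_congr_K _ _ _ fun x y w' => K3_eq_KB ends w a₁ a₂ a₃ w x y w'
  rw [h1, typedCount_peel_two KB killOB (st ends w a₁ a₂ a₃ w)
    (st_pendant_pair_cond ends a₁ a₂ a₃ w hg hleaf hwv hw1 hw2 hw3) F hgF z τ hτ,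
    ← typedCount_add]
  refine typedCount_congr_K _ _ _ fun x y w' => ?_
  have e1 := KB_killOB false true true (st ends w a₁ a₂ a₃ w x) (st ends w a₁ a₂ a₃ w y)
    (st ends w a₁ a₂ a₃ w w')
  have e2 := KB_killOB true false true (st ends w a₁ a₂ a₃ w x) (st ends w a₁ a₂ a₃ w y)
    (st ends w a₁ a₂ a₃ w w')
  have e3 := KB_killOB true true false (st ends w a₁ a₂ a₃ w x) (st ends w a₁ a₂ a₃ w y)
    (st ends w a₁ a₂ a₃ w w')
  simp only [cond_true, cond_false, Bool.and_self, Bool.and_true, Bool.and_false,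
    Bool.false_eq_true, if_false, if_true, add_zero, zero_add] at e1 e2 e3
  rw [e1, e2, e3, K3_eq_KB, KB_eq_KP_add]
  push_cast
  ring

/-- **The pendant-pair identity at class `2`**: `N₂ = N₃ + N₁` — the typed count with the pair
edge of class `2` is the count with the pair contracted (`g` of type `3`) plus the class-`1`
count. -/
theorem typedCount_pendant_pair_two {g : E} {v : V} (hg : ends g = s(w, v))
    (hleaf : ∀ e, w ∈ ends e → e = g) (hwv : w ≠ v) (hw1 : w ≠ a₁) (hw2 : w ≠ a₂)
    (hw3 : w ≠ a₃) (F : Finset E) (hgF : g ∈ F) (z : Config E) (τ : E → ℕ) (hτ : τ g = 2) :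
    typedCount F z τ (K3 ends w a₁ a₂ a₃ w : Config E → Config E → Config E → R) =
      typedCount F z (Function.update τ g 3) (K3 ends w a₁ a₂ a₃ w) +
      typedCount F z (Function.update τ g 1) (K3 ends w a₁ a₂ a₃ w) := by
  rw [typedCount_pendant_pair_two_pinned ends a₁ a₂ a₃ w hg hleaf hwv hw1 hw2 hw3 F hgF z τ hτ,
    typedCount_type_three F g hgF z _ (Function.update_self g 3 τ),
    typedCount_pendant_pair_one ends a₁ a₂ a₃ w hg hleaf hwv hw1 hw2 hw3 F hgF z _
      (Function.update_self g 1 τ)]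
  congr 1
  · exact typedCount_congr_τ _ _
      (fun e he => (Function.update_of_ne (Finset.mem_erase.1 he).1 3 τ).symm) _
  · exact typedCount_congr_τ _ _
      (fun e he => (Function.update_of_ne (Finset.mem_erase.1 he).1 1 τ).symm) _

/-- **`N₀ = 0` at a pendant pair**: with the pair isolated in every copy every term of `K₃`
vanishes. -/
theorem typedCount_pendant_pair_zero {g : E} {v : V} (hg : ends g = s(w, v))
    (hleaf : ∀ e, w ∈ ends e → e = g) (hwv : w ≠ v) (hw1 : w ≠ a₁) (hw2 : w ≠ a₂)
    (hw3 : w ≠ a₃) (F : Finset E) (hgF : g ∈ F) (z : Config E) (τ : E → ℕ) (hτ : τ g = 0) :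
    typedCount F z τ (K3 ends w a₁ a₂ a₃ w : Config E → Config E → Config E → R) = 0 := by
  have h1 : typedCount F z τ (K3 ends w a₁ a₂ a₃ w : Config E → Config E → Config E → R) =
      typedCount F z τ (fun x y w' => ((KB (st ends w a₁ a₂ a₃ w x) (st ends w a₁ a₂ a₃ w y)
        (st ends w a₁ a₂ a₃ w w') : ℤ) : R)) :=
    typedCount_congr_K _ _ _ fun x y w' => K3_eq_KB ends w a₁ a₂ a₃ w x y w'
  rw [h1, typedCount_peel KB killOB (st ends w a₁ a₂ a₃ w)
    (st_pendant_pair_cond ends a₁ a₂ a₃ w hg hleaf hwv hw1 hw2 hw3) F hgF z τ]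
  simp only [Fintype.sum_bool, Bool.toNat_true, Bool.toNat_false, hτ, cond_true, cond_false]
  norm_num
  rw [← Untouched.typedCount_zero_kernel (F.erase g) (Function.update z g true) τ]
  refine typedCount_congr_K _ _ _ fun x y w' => ?_
  have e := KB_killOB false false false (st ends w a₁ a₂ a₃ w x) (st ends w a₁ a₂ a₃ w y)
    (st ends w a₁ a₂ a₃ w w')
  simp only [cond_false, Bool.and_self, Bool.false_eq_true, if_false, add_zero] at e
  rw [e]
  push_cast
  rfl

end PairTwo

/-! ## Consequences: (T23) at the pair edge, and the reduction of row 2′TRI -/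

section Consequences

open Classical

variable {V : Type*} {E : Type*} [Fintype E] [DecidableEq E] {R : Type*} [Field R]
  [LinearOrder R] [IsStrictOrderedRing R]
variable (ends : E → Sym2 V) (a₁ a₂ a₃ w : V)

/-- **(T23) at a pendant pair**: the contracted count is at most the class-`2` count
(`N₃ ≤ N₂`, the difference being the class-`1` count `N₁ ≥ 0`). -/
theorem t23_pendant_pair {g : E} {v : V} (hg : ends g = s(w, v))
    (hleaf : ∀ e, w ∈ ends e → e = g) (hwv : w ≠ v) (hw1 : w ≠ a₁) (hw2 : w ≠ a₂)
    (hw3 : w ≠ a₃) (F : Finset E) (hgF : g ∈ F) (z : Config E) (τ : E → ℕ) (hτ : τ g = 2) :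
    typedCount F z (Function.update τ g 3)
        (K3 ends w a₁ a₂ a₃ w : Config E → Config E → Config E → R) ≤
      typedCount F z τ (K3 ends w a₁ a₂ a₃ w) := by
  rw [typedCount_pendant_pair_two ends a₁ a₂ a₃ w hg hleaf hwv hw1 hw2 hw3 F hgF z τ hτ]
  exact le_add_of_nonneg_right (typedCount_nonneg_of_pendant_pair_one ends a₁ a₂ a₃ w hg hleaf
    hwv hw1 hw2 hw3 F hgF z _ (Function.update_self g 1 τ))

/-- **Row 2′TRI at a class-`2` pendant pair reduces to the contracted instance**: if the typed count
with `g` of type `3` (the pair sitting at `v`) is nonnegative, so is the class-`2` count. -/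
theorem typedCount_nonneg_of_pendant_pair_two {g : E} {v : V} (hg : ends g = s(w, v))
    (hleaf : ∀ e, w ∈ ends e → e = g) (hwv : w ≠ v) (hw1 : w ≠ a₁) (hw2 : w ≠ a₂)
    (hw3 : w ≠ a₃) (F : Finset E) (hgF : g ∈ F) (z : Config E) (τ : E → ℕ) (hτ : τ g = 2)
    (h3 : 0 ≤ typedCount F z (Function.update τ g 3)
      (K3 ends w a₁ a₂ a₃ w : Config E → Config E → Config E → R)) :
    0 ≤ typedCount F z τ (K3 ends w a₁ a₂ a₃ w : Config E → Config E → Config E → R) :=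
  h3.trans (t23_pendant_pair ends a₁ a₂ a₃ w hg hleaf hwv hw1 hw2 hw3 F hgF z τ hτ)

/-- **The four Bernstein bases at a pendant pair**: `(N₀, N₁, N₂, N₃) = (0, N₁, N₁ + N₃, N₃)`
with `N₁ ≥ 0` — the pair edge satisfies the identity `N₂ = N₁ + N₃` of the series-`2` and
`(1,1)` pendant roots, for every class vector on the rest. -/
theorem pendant_pair_bases {g : E} {v : V} (hg : ends g = s(w, v))
    (hleaf : ∀ e, w ∈ ends e → e = g) (hwv : w ≠ v) (hw1 : w ≠ a₁) (hw2 : w ≠ a₂)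
    (hw3 : w ≠ a₃) (F : Finset E) (hgF : g ∈ F) (z : Config E) (τ : E → ℕ) :
    typedCount F z (Function.update τ g 0)
        (K3 ends w a₁ a₂ a₃ w : Config E → Config E → Config E → R) = 0 ∧
      0 ≤ typedCount F z (Function.update τ g 1)
        (K3 ends w a₁ a₂ a₃ w : Config E → Config E → Config E → R) ∧
      typedCount F z (Function.update τ g 2)
          (K3 ends w a₁ a₂ a₃ w : Config E → Config E → Config E → R) =
        typedCount F z (Function.update τ g 1) (K3 ends w a₁ a₂ a₃ w) +
          typedCount F z (Function.update τ g 3) (K3 ends w a₁ a₂ a₃ w) := by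
  refine ⟨typedCount_pendant_pair_zero ends a₁ a₂ a₃ w hg hleaf hwv hw1 hw2 hw3 F hgF z _
    (Function.update_self g 0 τ), typedCount_nonneg_of_pendant_pair_one ends a₁ a₂ a₃ w hg hleaf
    hwv hw1 hw2 hw3 F hgF z _ (Function.update_self g 1 τ), ?_⟩
  rw [typedCount_pendant_pair_two ends a₁ a₂ a₃ w hg hleaf hwv hw1 hw2 hw3 F hgF z _
    (Function.update_self g 2 τ), Function.update_idem, Function.update_idem, add_comm]

end Consequences

/-! ## The census form: `o` a leaf at `b`, `b` hanging by a class-`2` edge -/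

section Census

open Classical Contract Restrict

variable {V : Type*} {E : Type*} [DecidableEq V] [Fintype E] [DecidableEq E] {R : Type*} [Field R]
variable (ends : E → Sym2 V) (o a₁ a₂ a₃ b x : V)

omit [DecidableEq V] [Fintype E] in
/-- Restricting an updated type vector. -/
lemma rτ_update (S : Finset E) (τ : E → ℕ) {e : E} (he : e ∈ S) (k : ℕ) :
    rτ S (Function.update τ e k) = Function.update (rτ S τ) ⟨e, he⟩ k := by
  funext e'
  by_cases h : e' = ⟨e, he⟩
  · subst h
    show Function.update τ e k e = _
    rw [Function.update_self, Function.update_self]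
  · have h' : e'.1 ≠ e := fun h1 => h (Subtype.ext h1)
    show Function.update τ e k e'.1 = _
    rw [Function.update_of_ne h', Function.update_of_ne h]
    rfl

/-- **The census form of the class-`2` pair identity**: `o` a leaf at `b` by the typed edge `eob`
of class `≥ 1`, `b` carrying exactly the further edge `gp = {b, x}` of class `2`: the typed count
is `C(2, τ eob − 1)` times the sum of the count with `gp` contracted (type `3`) and the count with
`gp` of class `1`, both with `eob` of type `3`. -/
theorem typedCount_pendant_o_b_two {gp eob : E} (hgp : ends gp = s(b, x))
    (heob : ends eob = s(b, o)) (hleafo : ∀ e, o ∈ ends e → e = eob)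
    (hedgeb : ∀ e, b ∈ ends e → e = gp ∨ e = eob)
    (h1b : a₁ ≠ b) (h1o : a₁ ≠ o) (h2b : a₂ ≠ b) (h2o : a₂ ≠ o) (h3b : a₃ ≠ b) (h3o : a₃ ≠ o)
    (hbx : b ≠ x) (hob : o ≠ b) (hox : o ≠ x)
    (F : Finset E) (hgpF : gp ∈ F) (heobF : eob ∈ F) (z : Config E) (τ : E → ℕ)
    (hτp : τ gp = 2) (hτob : 1 ≤ τ eob) :
    typedCount F z τ (K3 ends o a₁ a₂ a₃ b : Config E → Config E → Config E → R) =
      (Nat.choose 2 (τ eob - 1) : R) *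
        (typedCount F z (Function.update (Function.update τ eob 3) gp 3) (K3 ends o a₁ a₂ a₃ b) +
          typedCount F z (Function.update (Function.update τ eob 3) gp 1)
            (K3 ends o a₁ a₂ a₃ b)) := by
  have hgpeob : gp ≠ eob := by
    intro h
    rw [h, heob, Sym2.eq_iff] at hgp
    rcases hgp with ⟨-, h1⟩ | ⟨h1, -⟩
    · exact hox h1
    · exact hbx h1
  -- the contraction of `eob` into `b`
  set W : Finset V := {b, o} with hW
  have hmem : ∀ v : V, v ∈ W ↔ v = b ∨ v = o := fun v => by
    rw [hW, Finset.mem_insert, Finset.mem_singleton]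
  have cmb : contractMap W b b = b := contractMap_of_mem ((hmem b).2 (Or.inl rfl))
  have cmo : contractMap W b o = b := contractMap_of_mem ((hmem o).2 (Or.inr rfl))
  have cmfix : ∀ v : V, v ≠ b → v ≠ o → contractMap W b v = v := fun v hv1 hv2 =>
    contractMap_of_notMem (fun h => by rcases (hmem v).1 h with h | h <;> contradiction)
  have cm1 := cmfix a₁ h1b h1o
  have cm2 := cmfix a₂ h2b h2o
  have cm3 := cmfix a₃ h3b h3o
  have cmx := cmfix x hbx.symm hox.symm
  set ends' := contractEnds ends W b with hends'
  have hloop : ends' eob = s(b, b) := by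
    rw [hends', contractEnds_apply, heob, Sym2.map_mk, cmb, cmo]
  have heobF' : eob ∉ F.erase eob := fun h => (Finset.mem_erase.1 h).1 rfl
  -- the support of the instance after the contraction
  set z' : Config E := Function.update z eob false with hz'
  set S : Finset E := F.erase eob ∪ Finset.univ.filter (fun e => z' e = true) with hS
  have hFS : F.erase eob ⊆ S := Finset.subset_union_left
  have hzS : ∀ e, e ∉ S → z' e = false := by
    intro e he
    by_contra h
    exact he (Finset.mem_union_right _ (Finset.mem_filter.2 ⟨Finset.mem_univ e,
      by simpa using h⟩))
  have heobS : eob ∉ S := by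
    intro h
    rcases Finset.mem_union.1 h with h | h
    · exact heobF' h
    · have := (Finset.mem_filter.1 h).2
      rw [hz', Function.update_self] at this
      exact Bool.false_ne_true this
  have hgpS : gp ∈ S := hFS (Finset.mem_erase.2 ⟨hgpeob, hgpF⟩)
  -- the reduction chain, for every type vector with `eob` of type `3`
  have chain : ∀ τ' : E → ℕ, τ' eob = 3 →
      typedCount F z τ' (K3 ends o a₁ a₂ a₃ b : Config E → Config E → Config E → R) =
        typedCount (rF S (F.erase eob)) (rConfig S z') (rτ S τ')
          (K3 (rEnds S ends') b a₁ a₂ a₃ b) := by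
    intro τ' hτ'
    rw [typedCount_type_three F eob heobF z _ hτ',
      typedCount_contract_open ends o a₁ a₂ a₃ b heob (F.erase eob) heobF'
        (Function.update z eob true) (Function.update_self eob true z),
      cmo, cm1, cm2, cm3, cmb, ← hends',
      typedCount_pinned_loop ends' b a₁ a₂ a₃ b hloop (F.erase eob) heobF' _
        (Function.update_self eob true z), Function.update_idem, ← hz',
      typedCount_restrict S ends' b a₁ a₂ a₃ b hFS hzS]
  -- the restricted instance: the pair `b` is a leaf at `gp`
  have hgp' : rEnds S ends' ⟨gp, hgpS⟩ = s(b, x) := by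
    show ends' gp = _
    rw [hends', contractEnds_apply, hgp, Sym2.map_mk, cmb, cmx]
  have hleafw' : ∀ e : S, b ∈ rEnds S ends' e → e = ⟨gp, hgpS⟩ := by
    intro e he
    change b ∈ ends' e.1 at he
    rw [hends', contractEnds_apply, Sym2.mem_map] at he
    obtain ⟨v, hv, hvb⟩ := he
    have hne : e.1 ≠ eob := fun h => heobS (h ▸ e.2)
    refine Subtype.ext ?_
    by_cases hvW : v ∈ W
    · rcases (hmem v).1 hvW with rfl | rfl
      · rcases hedgeb e.1 hv with h | h
        · exact h
        · exact absurd h hne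
      · exact absurd (hleafo e.1 hv) hne
    · rw [contractMap_of_notMem hvW] at hvb
      exact absurd ((hmem v).2 (Or.inl hvb)) hvW
  have hτ' : rτ S (Function.update τ eob 3) ⟨gp, hgpS⟩ = 2 := by
    show Function.update τ eob 3 gp = 2
    rw [Function.update_of_ne hgpeob]; exact hτp
  have h3 : ∀ k : ℕ, Function.update (Function.update τ eob 3) gp k eob = 3 := fun k => by
    rw [Function.update_of_ne hgpeob.symm, Function.update_self]
  have heob' : ends eob = s(o, b) := by rw [heob, Sym2.eq_swap]
  rw [typedCount_pendant_o ends o a₁ a₂ a₃ b heob' hleafo hob h1o.symm h2o.symm h3o.symm hob F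
    heobF z τ hτob]
  congr 1
  rw [chain _ (Function.update_self eob 3 τ), chain _ (h3 3), chain _ (h3 1),
    rτ_update S _ hgpS 3, rτ_update S _ hgpS 1]
  exact typedCount_pendant_pair_two (rEnds S ends') a₁ a₂ a₃ b hgp' hleafw' hbx h1b.symm h2b.symm
    h3b.symm (rF S (F.erase eob)) (mem_rF.2 (Finset.mem_erase.2 ⟨hgpeob, hgpF⟩)) (rConfig S z')
    (rτ S (Function.update τ eob 3)) hτ'

variable [LinearOrder R] [IsStrictOrderedRing R]

/-- **Row 2′TRI on the class-`2` census pair instances reduces to the contracted instance**: if the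
count with `o` and `b` contracted onto `x` (`eob`, `gp` of type `3`) is nonnegative, so is the
count with `gp` of class `2`. -/
theorem typedCount_nonneg_of_pendant_o_b_two {gp eob : E} (hgp : ends gp = s(b, x))
    (heob : ends eob = s(b, o)) (hleafo : ∀ e, o ∈ ends e → e = eob)
    (hedgeb : ∀ e, b ∈ ends e → e = gp ∨ e = eob)
    (h1b : a₁ ≠ b) (h1o : a₁ ≠ o) (h2b : a₂ ≠ b) (h2o : a₂ ≠ o) (h3b : a₃ ≠ b) (h3o : a₃ ≠ o)
    (hbx : b ≠ x) (hob : o ≠ b) (hox : o ≠ x)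
    (F : Finset E) (hgpF : gp ∈ F) (heobF : eob ∈ F) (z : Config E) (τ : E → ℕ)
    (hτp : τ gp = 2) (hτob : 1 ≤ τ eob)
    (h3 : 0 ≤ typedCount F z (Function.update (Function.update τ eob 3) gp 3)
      (K3 ends o a₁ a₂ a₃ b : Config E → Config E → Config E → R)) :
    0 ≤ typedCount F z τ (K3 ends o a₁ a₂ a₃ b : Config E → Config E → Config E → R) := by
  rw [typedCount_pendant_o_b_two ends o a₁ a₂ a₃ b x hgp heob hleafo hedgeb h1b h1o h2b h2o h3b
    h3o hbx hob hox F hgpF heobF z τ hτp hτob]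
  refine mul_nonneg (Nat.cast_nonneg _) (add_nonneg h3 ?_)
  have hgpeob : gp ≠ eob := by
    intro h
    rw [h, heob, Sym2.eq_iff] at hgp
    rcases hgp with ⟨-, h1⟩ | ⟨h1, -⟩
    · exact hox h1
    · exact hbx h1
  refine typedCount_nonneg_of_pendant_o_b ends a₁ a₂ a₃ o b x hgp heob hleafo hedgeb h1b h1o h2b
    h2o h3b h3o hbx hob hox F hgpF heobF z _ (Function.update_self gp 1 _) ?_
  rw [Function.update_of_ne hgpeob.symm, Function.update_self]
  norm_num

end Census

end TypedRed

end CovForm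

end Summit.Ventures.PercRepro2
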